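import Literature.Geometry.Symplectic.SphereIntersectionIndexHomologicalProofs

/-!
# Stub `stub_factIndexHomological` of line `cross-cap-laurent` (crux `GromovRecognitionRelEnd`,
item stmt-SmoothPoincare4-11009): the vendored fact F6' (winding indices of smooth spheres against
a compact co-oriented regular zero set add up to a homological invariant) is now PROVED in the
Literature tree (`Literature.Geometry.Symplectic.sphere_zeroSetIndex_factorsThroughHomology_holds`);
the stub is discharged by that theorem.
-/

-- the prescribed namespace `Summit.<P>.<Sub>.…` duplicates `SmoothPoincare4` (P = Sub)
set_option linter.dupNamespace false

namespace Summit.SmoothPoincare4.SmoothPoincare4.Theorems.GromovRecognitionRelEnd.CrossCapLaurent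

/-- **Stub F6' (registered `stub_factIndexHomological`)**: homological winding indices, discharged
by the Literature proof. -/
theorem stub_factIndexHomological :
    Literature.Geometry.Symplectic.sphere_zeroSetIndex_factorsThroughHomology :=
  Literature.Geometry.Symplectic.sphere_zeroSetIndex_factorsThroughHomology_holds

end Summit.SmoothPoincare4.SmoothPoincare4.Theorems.GromovRecognitionRelEnd.CrossCapLaurent
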